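import Literature.Probability.RandomPlanarGeometry.BDGS2012HaraSladeInversion
import Literature.Probability.RandomPlanarGeometry.BDGS2012GrahamLemma4
import HarnessLib

/-!
# The `1/d` expansion of the connective constant (BDGS 2012, §1.4, eq. (1.19)), VIII:
# integrality — the hyperoctahedral symmetry of the lace-graph counts

Sibling proof file of `Literature.Probability.RandomPlanarGeometry.BDGS2012` (namespace
`Literature.Probability.RandomPlanarGeometry.SAW.Zd`), sequel to `BDGS2012HaraSladeInversion.lean`,
which reduced `BDGS2012_HaraSlade_expansion` ("There exist integers `aᵢ ∈ ℤ` …", (1.19)) to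
Graham's bound (1.20) for `z_c` with the coefficients `αₙ = Graham2010.alpha c n` of
`BDGS2012GrahamReversion.lean`, PROVIDED the `c_{a,b}` are integers
(`haraSlade_expansion_of_graham_bound`). In the source they are: "The definition of the lace
expansion respects the symmetries of the underlying lattice. There are `2^d d!` ways of choosing an
ordered orthonormal basis for `ℝ^d` from the set `ℤ^d`. Each simple walk in `ℤ^d` with
dimensionality `D` is equivalent to `2d(2d-2)⋯(2d-2D+2)` other walks under the action of this
group of symmetries. Let `f_τ(a,N,D)` count the number of equivalence classes … we can write the
number of walks compatible with memory-`τ` laces of length `a` and type `N` in `ℤ^d` as a polynomial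
in powers of `s⁻¹ = 2d`: `Σ_{D=1}^{⌊a/2⌋} f_τ(a,N,D)·2d(2d-2)⋯(2d-2D+2) = Σ_b c_{a,b,N} s^{b-a}`"
(Graham 2010, §4), so the `c_{a,b,N}` — coefficients of an integer polynomial in `2d` — are
integers. The tree's `BDGS2012GrahamDimension.lean` / `BDGS2012GrahamLemma4.lean` count LABELLED
lace graphs instead (`diagDim a M D` = the number of `a`-step lace graphs of order `M+1` in `ℤ^D`
using all `D` coordinates) and book the symmetry factor as a division:
`cTyp a M j = Σ_D diagDim a M D · [X^j]∏_{i<D}(X-2i) / (2^D D!)`, `grahamC a b = Σ_M (-1)^M cTyp a M (a-b)`.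
This file supplies the missing group-theoretic fact and closes the integrality:

* `card_dvd_card_of_free_action` — a finite family of maps closed under composition and inverses,
  acting freely on an invariant finite set `S`, has `|𝒢| ∣ |S|` (orbit decomposition, by induction);
* the hyperoctahedral action on step sequences: `relabelDir / relabelSeq φ ε` (coordinate `j ↦ φ j`,
  sign flipped where `ε j`; any injection `φ : Fin D → Fin d`), the induced additive embedding
  `relabelSite φ ε : ℤ^D →+ ℤ^d`, `pos_relabelSeq` (`ω' = L ∘ ω`), and the invariance of the lace
  data of Slade 2006 §3.1: `lacePair_relabelSeq`, `laceTime_relabelSeq`, **`isDiag_relabelSeq_iff`**,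
  `usedDirs_relabelSeq`;
* **`two_pow_mul_factorial_dvd_dimCount`** — for a property of `n`-step walks of `ℤ^D` invariant
  under signed permutations of the coordinates, `2^D·D! ∣ #{τ | P τ ∧ τ uses all D coordinates}`
  (the action of the `2^D D!` signed permutations is free on walks using every coordinate), whence
  **`two_pow_mul_factorial_dvd_diagDim`** (`2^D D! ∣ diagDim a M D`: Graham's `f(a, M+1, D)` is
  `diagDim a M D / (2^D D!)`), **`Graham2010.cTyp_exists_int`**, **`Graham2010.grahamC_exists_int`**
  (`c_{a,b,N}, c_{a,b} ∈ ℤ`);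
* **`haraSlade_expansion_of_grahamC_bound`** / `haraSlade_expansion_of_grahamC_isBigO` — Graham's
  Theorem 1 in explicit form, `|z_c(d) - Σ_{i=1}^{M-1} αᵢ/(2d)^i| ≤ C^M M!/(2d)^M` (`M ≥ 1`, `d ≥ d₀`)
  with `αᵢ = alpha grahamC i`, or just its `O(d^{-M})` consequence for each `M`, implies
  `BDGS2012_HaraSlade_expansion` with no further hypothesis.

Not here: Graham's Theorem 1 itself (the analytic input; `BDGS2012GrahamLemma4.lean` ff.).
-/

noncomputable section

open Finset Filter Topology Asymptotics
open Literature.Probability.LatticeModels Literature.Probability.LatticeModels.SRW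
open Literature.Barriers.CriticalPhenomena Literature.Barriers.CriticalPhenomena.SAWLace
open scoped BigOperators

namespace Literature.Probability.RandomPlanarGeometry.SAW.Zd

/-! ### Free actions: `|𝒢| ∣ |S|` -/

/-- **Orbit counting for a free action.** Let `𝒢` be a nonempty finite family of maps of `Y`,
closed under composition and under inverses, let `S` be a finite `𝒢`-invariant set on which `𝒢`
acts freely (`g s = h s ⟹ g = h`). Then `|𝒢|` divides `|S|` (every orbit in `S` has exactly `|𝒢|`
elements). This is the counting behind "each simple walk … with dimensionality `D` is equivalent to
`2d(2d-2)⋯(2d-2D+2)` other walks under the action of this group of symmetries".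
[cite: Graham2010, Section 4] -/
theorem card_dvd_card_of_free_action {G Y : Type*} [DecidableEq Y] (𝒢 : Finset G)
    (act : G → Y → Y) (hne : 𝒢.Nonempty)
    (hmul : ∀ g ∈ 𝒢, ∀ h ∈ 𝒢, ∃ k ∈ 𝒢, ∀ y, act k y = act g (act h y))
    (hinv : ∀ g ∈ 𝒢, ∃ k ∈ 𝒢, ∀ y, act k (act g y) = y) (S : Finset Y)
    (hS : ∀ g ∈ 𝒢, ∀ s ∈ S, act g s ∈ S)
    (hfree : ∀ g ∈ 𝒢, ∀ h ∈ 𝒢, ∀ s ∈ S, act g s = act h s → g = h) :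
    𝒢.card ∣ S.card := by
  induction S using Finset.strongInduction with
  | H S ih =>
    rcases S.eq_empty_or_nonempty with hS0 | ⟨s, hs⟩
    · rw [hS0, card_empty]
      exact dvd_zero _
    -- the orbit of `s`
    set O : Finset Y := 𝒢.image fun g => act g s with hO
    have hOS : O ⊆ S := by
      intro y hy
      obtain ⟨g, hg, rfl⟩ := mem_image.1 hy
      exact hS g hg s hs
    have hOcard : O.card = 𝒢.card :=
      card_image_of_injOn fun g hg h hh e => hfree g hg h hh s hs e
    have hOne : O.Nonempty := by
      obtain ⟨g, hg⟩ := hne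
      exact ⟨act g s, mem_image_of_mem _ hg⟩
    -- the complement is invariant
    have hS' : ∀ g ∈ 𝒢, ∀ t ∈ S \ O, act g t ∈ S \ O := by
      intro g hg t ht
      have ht1 : t ∈ S := (mem_sdiff.1 ht).1
      have ht2 : t ∉ O := (mem_sdiff.1 ht).2
      refine mem_sdiff.2 ⟨hS g hg t ht1, fun hmem => ht2 ?_⟩
      obtain ⟨h, hh, he⟩ := mem_image.1 hmem
      obtain ⟨k, hk, hkinv⟩ := hinv g hg
      obtain ⟨m, hm, hme⟩ := hmul k hk h hh
      rw [hO, mem_image]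
      exact ⟨m, hm, by rw [hme, he, hkinv]⟩
    have hdvd : 𝒢.card ∣ (S \ O).card :=
      ih (S \ O) (sdiff_ssubset hOS hOne) hS'
        fun g hg h hh t ht e => hfree g hg h hh t (mem_sdiff.1 ht).1 e
    rw [← card_sdiff_add_card_eq_card hOS, hOcard]
    exact dvd_add hdvd (dvd_refl _)

/-! ### Signed relabelling of the coordinates -/

section Relabel

variable {D d : ℕ}

/-- Transport of a direction of `ℤ^D` along `φ : Fin D → Fin d` with sign flips `ε`:
`(j, b) ↦ (φ j, b xor ε j)` (for a bijection `φ` of `Fin D` this is a signed permutation of the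
coordinates, an element of the hyperoctahedral group of order `2^D D!`). [cite: Graham2010, Section 4] -/
def relabelDir (φ : Fin D → Fin d) (ε : Fin D → Bool) (v : Dir D) : Dir d := (φ v.1, xor v.2 (ε v.1))

/-- Transport of a step sequence, step by step. [cite: Graham2010, Section 4] -/
def relabelSeq {n : ℕ} (φ : Fin D → Fin d) (ε : Fin D → Bool) (σ : StepSeq D n) : StepSeq d n :=
  fun i => relabelDir φ ε (σ i)

/-- The coordinate of a transported step. [folklore] -/
@[simp] theorem fst_relabelSeq {n : ℕ} (φ : Fin D → Fin d) (ε : Fin D → Bool) (σ : StepSeq D n)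
    (i : Fin n) : (relabelSeq φ ε σ i).1 = φ (σ i).1 := rfl

/-- The sign of a transported step. [folklore] -/
@[simp] theorem snd_relabelSeq {n : ℕ} (φ : Fin D → Fin d) (ε : Fin D → Bool) (σ : StepSeq D n)
    (i : Fin n) : (relabelSeq φ ε σ i).2 = xor (σ i).2 (ε (σ i).1) := rfl

/-- The induced additive map `ℤ^D → ℤ^d`: coordinate `j` goes to coordinate `φ j`, with sign `-`
where `ε j`. [folklore] -/
def relabelSite (φ : Fin D → Fin d) (ε : Fin D → Bool) : Site D →+ Site d where
  toFun x := fun k => ∑ j : Fin D, if φ j = k then (if ε j then -x j else x j) else 0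
  map_zero' := by
    funext k
    simp
  map_add' x y := by
    funext k
    simp only [Pi.add_apply]
    rw [← Finset.sum_add_distrib]
    refine Finset.sum_congr rfl fun j _ => ?_
    split_ifs <;> ring

/-- The value of the transported site at a coordinate `φ j` of the range (`φ` injective).
[folklore] -/
theorem relabelSite_apply_image {φ : Fin D → Fin d} (hφ : Function.Injective φ) (ε : Fin D → Bool)
    (x : Site D) (j : Fin D) : relabelSite φ ε x (φ j) = if ε j then -x j else x j := by
  change (∑ j' : Fin D, if φ j' = φ j then (if ε j' then -x j' else x j') else 0) = _
  rw [Finset.sum_eq_single j]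
  · rw [if_pos rfl]
  · intro j' _ hj'
    rw [if_neg fun h => hj' (hφ h)]
  · intro h; exact absurd (Finset.mem_univ j) h

/-- `relabelSite φ ε` is injective when `φ` is. [folklore] -/
theorem relabelSite_injective {φ : Fin D → Fin d} (hφ : Function.Injective φ) (ε : Fin D → Bool) :
    Function.Injective (relabelSite φ ε) := by
  intro x y h
  funext j
  have := congrFun h (φ j)
  rw [relabelSite_apply_image hφ, relabelSite_apply_image hφ] at this
  split_ifs at this with hj
  · exact neg_injective this
  · exact this

/-- Unit steps are transported to unit steps: `L(e_v) = e_{relabelDir v}`. [folklore] -/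
theorem relabelSite_stepVec (φ : Fin D → Fin d) (ε : Fin D → Bool) (v : Dir D) :
    relabelSite φ ε (stepVec v) = stepVec (relabelDir φ ε v) := by
  funext k
  change (∑ j : Fin D, if φ j = k then (if ε j then -stepVec v j else stepVec v j) else 0) = _
  rw [Finset.sum_eq_single v.1]
  · rw [stepVec_apply, stepVec_apply]
    simp only [relabelDir, if_true]
    by_cases hk : φ v.1 = k
    · rw [if_pos hk, if_pos hk.symm]
      rcases Bool.eq_false_or_eq_true v.2 with h2 | h2 <;>
        rcases Bool.eq_false_or_eq_true (ε v.1) with h3 | h3 <;> simp [h2, h3]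
    · rw [if_neg hk, if_neg fun h => hk h.symm]
  · intro j _ hj
    rw [stepVec_apply, if_neg hj]
    split_ifs <;> simp
  · intro h; exact absurd (Finset.mem_univ _) h

/-- **Positions of the transported walk**: `ω'(t) = L(ω(t))`. [folklore] -/
theorem pos_relabelSeq {n : ℕ} (φ : Fin D → Fin d) (ε : Fin D → Bool) (σ : StepSeq D n) (t : ℕ) :
    pos (relabelSeq φ ε σ) t = relabelSite φ ε (pos σ t) := by
  unfold pos
  rw [map_sum]
  refine Finset.sum_congr rfl fun i _ => ?_
  split_ifs
  · exact (relabelSite_stepVec φ ε (σ i)).symm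
  · exact (map_zero _).symm

/-- **The lace data are invariant under transport** (`φ` injective): they depend on the walk only
through the coincidences `ω(s) = ω(t)`. [cite: Graham2010, Section 4] -/
theorem lacePair_relabelSeq {n : ℕ} {φ : Fin D → Fin d} (hφ : Function.Injective φ)
    (ε : Fin D → Bool) (σ : StepSeq D n) (i : ℕ) :
    lacePair (relabelSeq φ ε σ) i = lacePair σ i := by
  induction i with
  | zero => rfl
  | succ i ih =>
    change ((lacePair (relabelSeq φ ε σ) i).2, firstHit (relabelSeq φ ε σ)
        (lacePair (relabelSeq φ ε σ) i).2 (pos (relabelSeq φ ε σ) ''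
          Set.Icc (lacePair (relabelSeq φ ε σ) i).1 (lacePair (relabelSeq φ ε σ) i).2)) =
      ((lacePair σ i).2, firstHit σ (lacePair σ i).2
        (pos σ '' Set.Icc (lacePair σ i).1 (lacePair σ i).2))
    rw [ih, Graham2010.firstHit_congr_pred₂]
    intro t
    simp only [pos_relabelSeq, Set.mem_image]
    constructor
    · rintro ⟨u, hu, he⟩; exact ⟨u, hu, relabelSite_injective hφ ε he⟩
    · rintro ⟨u, hu, he⟩; exact ⟨u, hu, by rw [he]⟩

/-- Lace times are invariant under transport. [cite: Graham2010, Section 4] -/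
theorem laceTime_relabelSeq {n : ℕ} {φ : Fin D → Fin d} (hφ : Function.Injective φ)
    (ε : Fin D → Bool) (σ : StepSeq D n) (i : ℕ) :
    laceTime (relabelSeq φ ε σ) i = laceTime σ i :=
  congrArg Prod.snd (lacePair_relabelSeq hφ ε σ (i + 1))

/-- **`IsDiag` is invariant under transport** (`φ` injective): a lace graph of order `M + 1` in
`ℤ^D` is carried to a lace graph of order `M + 1` in `ℤ^d`, and conversely.
[cite: Graham2010, Section 4] -/
theorem isDiag_relabelSeq_iff {n : ℕ} {φ : Fin D → Fin d} (hφ : Function.Injective φ)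
    (ε : Fin D → Bool) (σ : StepSeq D n) (M : ℕ) :
    IsDiag (relabelSeq φ ε σ) M ↔ IsDiag σ M := by
  have hT : ∀ i, laceTime (relabelSeq φ ε σ) i = laceTime σ i :=
    fun i => laceTime_relabelSeq hφ ε σ i
  have hS : ∀ i, laceStart (relabelSeq φ ε σ) i = laceStart σ i := fun i =>
    congrArg Prod.snd (lacePair_relabelSeq hφ ε σ i)
  have hinj : ∀ S : Set ℕ, Set.InjOn (pos (relabelSeq φ ε σ)) S ↔ Set.InjOn (pos σ) S := by
    intro S
    simp only [Set.InjOn, pos_relabelSeq, (relabelSite_injective hφ ε).eq_iff]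
  simp only [IsDiag, hT, hS, hinj]

/-- The coordinates used by the transported walk are the `φ`-image of those used by the walk.
[folklore] -/
theorem usedDirs_relabelSeq {n : ℕ} (φ : Fin D → Fin d) (ε : Fin D → Bool)
    (σ : StepSeq D n) : Graham2010.usedDirs (relabelSeq φ ε σ) = (Graham2010.usedDirs σ).image φ := by
  ext k
  rw [Graham2010.mem_usedDirs, mem_image]
  constructor
  · rintro ⟨i, hi⟩
    exact ⟨(σ i).1, Graham2010.fst_mem_usedDirs σ i, hi⟩
  · rintro ⟨j, hj, rfl⟩
    obtain ⟨i, hi⟩ := (Graham2010.mem_usedDirs σ j).1 hj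
    exact ⟨i, by rw [fst_relabelSeq, hi]⟩

/-- Composition of signed permutations is a signed permutation:
`(φ,ε) ∘ (φ',ε') = (φφ', j ↦ ε' j xor ε (φ' j))`. [folklore] -/
theorem relabelSeq_relabelSeq {n : ℕ} (φ φ' : Fin D → Fin D) (ε ε' : Fin D → Bool)
    (σ : StepSeq D n) :
    relabelSeq φ ε (relabelSeq φ' ε' σ) =
      relabelSeq (φ ∘ φ') (fun j => xor (ε' j) (ε (φ' j))) σ := by
  funext i
  refine Prod.ext rfl ?_
  simp only [snd_relabelSeq, fst_relabelSeq, Bool.xor_assoc]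

/-- The inverse signed permutation undoes the transport. [folklore] -/
theorem relabelSeq_symm_relabelSeq {n : ℕ} (φ : Equiv.Perm (Fin D)) (ε : Fin D → Bool)
    (σ : StepSeq D n) :
    relabelSeq φ.symm (fun j => ε (φ.symm j)) (relabelSeq φ ε σ) = σ := by
  funext i
  refine Prod.ext ?_ ?_
  · simp only [fst_relabelSeq, Equiv.symm_apply_apply]
  · simp only [snd_relabelSeq, fst_relabelSeq, Equiv.symm_apply_apply, Bool.xor_assoc,
      Bool.xor_self, Bool.xor_false]

/-- **Freeness**: a signed permutation fixing (the transport class of) a walk that uses every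
coordinate is determined by it — if `(φ,ε)·σ = (φ',ε')·σ` and `σ` uses all coordinates then
`φ = φ'` and `ε = ε'`. [cite: Graham2010, Section 4] -/
theorem relabelSeq_eq_relabelSeq_imp {n : ℕ} {φ φ' : Fin D → Fin d}
    {ε ε' : Fin D → Bool} {σ : StepSeq D n} (hσ : Graham2010.usedDirs σ = univ)
    (h : relabelSeq φ ε σ = relabelSeq φ' ε' σ) : φ = φ' ∧ ε = ε' := by
  have key : ∀ j : Fin D, φ j = φ' j ∧ ε j = ε' j := by
    intro j
    obtain ⟨i, hi⟩ := (Graham2010.mem_usedDirs σ j).1 (by rw [hσ]; exact mem_univ j)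
    have h1 := congrArg Prod.fst (congrFun h i)
    have h2 := congrArg Prod.snd (congrFun h i)
    simp only [fst_relabelSeq, hi] at h1
    simp only [snd_relabelSeq, hi] at h2
    refine ⟨h1, ?_⟩
    revert h2
    cases (σ i).2 <;> cases ε j <;> cases ε' j <;> simp
  exact ⟨funext fun j => (key j).1, funext fun j => (key j).2⟩

end Relabel

/-! ### `2^D D!` divides the number of walks using every coordinate -/

/-- **The hyperoctahedral symmetry of a coordinate-symmetric count.** If a property `P` of `n`-step
walks of `ℤ^D` is invariant under the signed permutations of the coordinates, then the number of
walks with `P` using ALL `D` coordinates is divisible by `2^D · D!`: the `2^D D!` signed permutations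
act freely on such walks ("Each simple walk in `ℤ^d` with dimensionality `D` is equivalent to
`2d(2d-2)⋯(2d-2D+2)` other walks under the action of this group of symmetries"; for `d = D` this
number is `2^D D!`). [cite: Graham2010, Section 4] -/
theorem two_pow_mul_factorial_dvd_dimCount {n : ℕ} (P : ∀ d : ℕ, StepSeq d n → Prop)
    [∀ d, DecidablePred (P d)] (D : ℕ)
    (hP : ∀ (φ : Equiv.Perm (Fin D)) (ε : Fin D → Bool) (τ : StepSeq D n),
      P D (relabelSeq φ ε τ) ↔ P D τ) :
    2 ^ D * D.factorial ∣ Graham2010.dimCount n P D := by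
  classical
  have hcard : (univ : Finset (Equiv.Perm (Fin D) × (Fin D → Bool))).card = 2 ^ D * D.factorial := by
    rw [card_univ, Fintype.card_prod, Fintype.card_perm, Fintype.card_fun, Fintype.card_bool,
      Fintype.card_fin, mul_comm]
  rw [← hcard]
  unfold Graham2010.dimCount
  refine card_dvd_card_of_free_action univ
    (fun (g : Equiv.Perm (Fin D) × (Fin D → Bool)) (τ : StepSeq D n) => relabelSeq g.1 g.2 τ)
    univ_nonempty ?_ ?_ _ ?_ ?_
  · intro g _ h _
    refine ⟨(g.1 * h.1, fun j => xor (h.2 j) (g.2 (h.1 j))), mem_univ _, fun τ => ?_⟩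
    rw [relabelSeq_relabelSeq]
    rfl
  · intro g _
    exact ⟨(g.1.symm, fun j => g.2 (g.1.symm j)), mem_univ _, fun τ => relabelSeq_symm_relabelSeq _ _ τ⟩
  · intro g _ τ hτ
    rw [mem_filter] at hτ ⊢
    refine ⟨mem_univ _, (hP g.1 g.2 τ).2 hτ.2.1, ?_⟩
    rw [usedDirs_relabelSeq, hτ.2.2]
    exact image_univ_equiv g.1
  · intro g _ h _ τ hτ e
    rw [mem_filter] at hτ
    obtain ⟨h1, h2⟩ := relabelSeq_eq_relabelSeq_imp hτ.2.2 e
    exact Prod.ext (Equiv.ext fun j => congrFun h1 j) h2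

/-- **`2^D · D! ∣ diagDim a M D`**: the number of `a`-step lace graphs of order `M + 1` in `ℤ^D`
using all `D` coordinates is `2^D D!` times Graham's number `f(a, M+1, D)` of their classes under
the signed permutations of the coordinates. [cite: Graham2010, Section 4] -/
theorem two_pow_mul_factorial_dvd_diagDim (a M D : ℕ) :
    2 ^ D * D.factorial ∣ Graham2010.diagDim a M D := by
  classical
  unfold Graham2010.diagDim
  convert two_pow_mul_factorial_dvd_dimCount (n := a)
    (fun D (σ : StepSeq D a) => IsDiag σ M ∧ laceTime σ M = a) D ?_ using 2
  intro φ ε τ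
  rw [isDiag_relabelSeq_iff φ.injective, laceTime_relabelSeq φ.injective]

/-! ### Integrality of `c_{a,b,N}` and `c_{a,b}` -/

/-- **`c_{a,b,N} ∈ ℤ`**: `cTyp a M j = Σ_D f(a,M+1,D)·[X^j]∏_{i<D}(X - 2i)` with
`f = diagDim/(2^D D!) ∈ ℕ` — the coefficients of "a polynomial in powers of `s⁻¹ = 2d`" with integer
coefficients. [cite: Graham2010, Section 4] -/
theorem Graham2010.cTyp_exists_int (a M j : ℕ) : ∃ z : ℤ, Graham2010.cTyp a M j = z := by
  unfold Graham2010.cTyp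
  refine exists_int_sum _ fun D _ => ?_
  obtain ⟨q, hq⟩ := two_pow_mul_factorial_dvd_diagDim a M D
  refine ⟨q * Graham2010.pcoef D j, ?_⟩
  have hpos : (0 : ℝ) < (2 : ℝ) ^ D * (D.factorial : ℝ) := by positivity
  rw [hq, div_eq_iff hpos.ne']
  push_cast
  ring

/-- **`c_{a,b} ∈ ℤ`** ("`c_{a,b} = Σ_N (-1)^{N+1} c_{a,b,N}`"). [cite: Graham2010, Section 4] -/
theorem Graham2010.grahamC_exists_int (a b : ℕ) : ∃ z : ℤ, Graham2010.grahamC a b = z := by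
  unfold Graham2010.grahamC
  refine exists_int_sum _ fun M _ => exists_int_mul ⟨(-1) ^ M, by simp⟩ ?_
  exact Graham2010.cTyp_exists_int a M (a - b)

/-- Hence Graham's `αₙ` for the self-avoiding walk, `alpha grahamC n`, are integers.
[cite: Graham2010, Section 4, eq. (4.2)] -/
theorem Graham2010.alpha_grahamC_exists_int (n : ℕ) :
    ∃ z : ℤ, Graham2010.alpha Graham2010.grahamC n = z :=
  Graham2010.alpha_exists_int Graham2010.grahamC_exists_int n

/-! ### (1.19) from Graham's Theorem 1 with the SAW coefficients -/

/-- **(1.19) from (1.20) in explicit form.** If `z_c(d) - Σ_{i=1}^{M-1} αᵢ/(2d)^i = O(d^{-M})` for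
every `M`, with Graham's SAW coefficients `αᵢ = alpha grahamC i`, then
`BDGS2012_HaraSlade_expansion` holds (integer `aᵢ`). [cite: BDGS2012, §1.4, eqs. (1.19)–(1.20)] -/
theorem haraSlade_expansion_of_grahamC_isBigO
    (h : ∀ M : ℕ, (fun d : ℕ => criticalPoint d -
        ∑ i ∈ Ico 1 M, Graham2010.alpha Graham2010.grahamC i / (2 * (d : ℝ)) ^ i)
      =O[atTop] fun d : ℕ => (d : ℝ) ^ (-(M : ℤ))) :
    BDGS2012_HaraSlade_expansion :=
  haraSlade_expansion_of_graham_alpha Graham2010.grahamC_exists_int h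

/-- **(1.19) from Graham's Theorem 1.** If, for some `C` and `d₀`,
`|z_c(d) - Σ_{i=1}^{M-1} αᵢ/(2d)^i| ≤ C^M M!/(2d)^M` for all `M ≥ 1` and `d ≥ d₀`, with Graham's SAW
coefficients `αᵢ = alpha grahamC i` ("When `τ = ∞`, the `α_{n,τ}` are exactly the `αₙ` that
appear in (1.1)"), then `BDGS2012_HaraSlade_expansion` holds: "the connective constant `μ` has an
asymptotic expansion in integer powers of `1/(2d)` to all orders, with all the coefficients taking
integer values". [cite: BDGS2012, §1.4, eqs. (1.19)–(1.20); Graham2010, Theorem 1 and Section 4] -/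
theorem haraSlade_expansion_of_grahamC_bound
    (h : ∃ C : ℝ, ∃ d₀ : ℕ, ∀ M d : ℕ, 1 ≤ M → d₀ ≤ d →
      |criticalPoint d - ∑ i ∈ Ico 1 M, Graham2010.alpha Graham2010.grahamC i / (2 * (d : ℝ)) ^ i| ≤
        C ^ M * (M.factorial : ℝ) / (2 * (d : ℝ)) ^ M) :
    BDGS2012_HaraSlade_expansion :=
  haraSlade_expansion_of_graham_bound Graham2010.grahamC_exists_int h

end Literature.Probability.RandomPlanarGeometry.SAW.Zd
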